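import Mathlib.Combinatorics.SimpleGraph.Finite
import Mathlib.Data.Finset.Sort
import Mathlib.Data.Real.Basic
import Literature.Computability.MetaComplexity.PolynomialCalculusCNF
import HarnessLib

/-!
# The graph ordering principle of Galesi–Lauria and its polynomial-calculus degree lower bound (named fact)

Galesi–Lauria (ACM ToCL 2010) prove a PC degree lower bound for a polynomial encoding of the
GRAPH ORDERING PRINCIPLE over vertex expanders — the standard INPUT of the "indirect route" to
Res(⊕) width/space/tree-like-size lower bounds (Gryaznov–Ovcharov–Riazanov 2024, Thm 8 = this
theorem, Cor. 2, Thm 9; Efremenko–Garlík–Itsykson 2024, §1.1.1).  This file TYPES their objects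
and states their Theorem 1 as a named fact (not proved here):

* `IsVertexExpander G r c` — GL10 Def. 1: every `U ⊆ V` with `|U| ≤ r` has `|Γ(U)| ≥ c|U|`, where
  `Γ(U)` (`outerNeighbors G U`) is the set of vertices OUTSIDE `U` with a neighbour in `U`;
* `GOP.var n a b = a·n + b` — the index of GL10's variable `x_{a,b}` (`a < b`, "`a ≺ b`");
  `GOP.precLit n a b` — the literal "`a ≺ b`" (`x_{a,b}` if `a < b`, `¬x_{b,a}` if `b < a`);
* `GOP.glGOP G : CNF ℕ` — GL10's system `GOP(G)` written as the CNF whose Krajíček translation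
  (`PC.ofCNF`, file `PolynomialCalculusCNF.lean`) it is: for all `a < b < c` the two "no 3-cycle"
  clauses `¬x_{ab} ∨ ¬x_{bc} ∨ x_{ac}` and `x_{ab} ∨ x_{bc} ∨ ¬x_{ac}` (GL10 (2), (3):
  `x_{ab}x_{bc}(1 - x_{ac})`, `(1 - x_{ab})(1 - x_{bc})x_{ac}`), and for every vertex `u` the clause
  `M_u = ⋁_{a ∈ Γ(u)} (a ≺ u)` (GL10 (4): `∏_{a ∈ Γ(u), a<u}(1 - x_{a,u}) · ∏_{a ∈ Γ(u), a>u} x_{u,a}`);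
* `GalesiLauria2010_PC_GOP_degree` — NAMED FACT, GL10 Thm 1: if `G` is an `(r, c)`-vertex
  expander then `GOP(G)` has no PC refutation (over any field) of degree `≤ cr/4`.

## Sources (held copy `paper:doi-10-1145-1838552-1838556`)

* N. Galesi, M. Lauria, *Optimality of size-degree tradeoffs for polynomial calculus*, ACM ToCL
  12(1) (2010) [GalesiLauria2010]: §2.1 (PC over a field, Boolean axioms implicit, sum and product
  rule, degree of a proof = maximal degree of a line), Def. 1 p. 7 (vertex expanders), §3 pp. 7–8
  (the encoding (2)–(4), variables `x_{a,b}`, `a < b`), Theorem 1 p. 9 (verbatim: "If G is an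
  (r, c)-vertex expander then there is no PC refutation of GOP(G) of degree less than or equal to
  cr/4.").
* S. Gryaznov, S. Ovcharov, A. Riazanov, ACM ToCT (2024), Thm 8 (the same bound quoted for their
  CNF encoding with antisymmetry/totality axioms) [GryaznovOvcharovRiazanov2024].

## Design notes

* The fact is stated for GL10's OWN encoding (one variable per pair `a < b`, no antisymmetry or
  totality axioms), exactly as proved there; GOR's Thm 8 (two variables per pair) is a different
  statement and is not vendored.
* Implicit hypotheses of print made explicit: `1 ≤ r` and `0 < c` (GL10 work with `r = Θ(n)`,
  `c = Θ(1)`; with `r = 0` the expansion hypothesis is vacuous and the displayed sentence would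
  fail for graphs with an isolated vertex, whose `M_u` is the constant `1`).  With them every vertex
  has a neighbour, so no axiom is constant.  "degree `≤ cr/4`" for an integer degree bound `d` is
  `(d : ℝ) ≤ c * r / 4`.
* A STANDING ASSUMPTION OF PRINT IS DROPPED: GL10 p. 7 ("Whenever we say in the following that G is
  an (r, c)-vertex expander, we assume it has constant degree") and p. 9 ("we assume G to be given
  and to be a constant degree (r, c)-vertex expander").  The named fact below quantifies over every
  single graph `G` with no degree hypothesis, because (i) "constant degree" is a property of a
  FAMILY of graphs and has no content for one graph, and (ii) the proof of Lemma 2 / Theorem 1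
  (GL10 pp. 9–13; reproduced in `GraphOrderingPrincipleDegreeProof.lean`, which discharges the fact)
  never uses `deg(G)` — the degree of `G` enters only the clause WIDTH of `GOP(G)`
  (`GOP.length_minClause`, `GOP.isWidthLE_glGOP`) and hence only the size/width side of GL10's
  trade-off (their Lemma 1, Theorem 2) and the Res(⊕) rail corollaries, which carry
  `∀ u, G.degree u ≤ d` explicitly.  (Referee item W-A326-1.)
* PC = the tree's `PC.DerivableInDegree` (Krajíček's PC/F: explicit Boolean axioms, product rule by
  an arbitrary polynomial inside the degree bound) — the same degree-bounded strength as GL10's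
  (product by a variable; a product by `h` inside degree `d` is a sum of products by monomials, each
  inside degree `d`).
* Not here: GL10's Lemma 1 (short refutations), Lemma 2 (the operator `L`), Theorem 2 (the
  trade-off optimality), PCR.
-/

noncomputable section

namespace Literature.Computability.MetaComplexity

open Literature.Computability.Complexity

/-! ### Vertex expanders (GL10 Def. 1) -/

section Expander

variable {V : Type*} [Fintype V] [DecidableEq V] (G : SimpleGraph V) [DecidableRel G.Adj]

/-- `Γ(U)`: the vertices outside `U` having a neighbour in `U`. [Galesi–Lauria 2010, Def. 1]
[cite: GalesiLauria2010, Def. 1] -/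
def outerNeighbors (U : Finset V) : Finset V :=
  Finset.univ.filter fun v => v ∉ U ∧ ∃ u ∈ U, G.Adj u v

/-- Membership in `Γ(U)`. [Galesi–Lauria 2010, Def. 1] [cite: GalesiLauria2010, Def. 1] -/
theorem mem_outerNeighbors {U : Finset V} {v : V} :
    v ∈ outerNeighbors G U ↔ v ∉ U ∧ ∃ u ∈ U, G.Adj u v := by
  simp [outerNeighbors]

/-- **`(r, c)`-vertex expander**: every vertex set `U` with `|U| ≤ r` has `|Γ(U)| ≥ c·|U|`.
[Galesi–Lauria 2010, Def. 1 ("The graph G is said to be an (r, c)-vertex expander if for any set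
U ⊆ V with |U| ≤ r, |Γ(U)| ≥ c|U|")] [cite: GalesiLauria2010, Def. 1] -/
def IsVertexExpander (r : ℕ) (c : ℝ) : Prop :=
  ∀ U : Finset V, U.card ≤ r → c * U.card ≤ ((outerNeighbors G U).card : ℝ)

/-- In an `(r, c)`-vertex expander with `r ≥ 1`, `c > 0` every vertex has a neighbour.
[Galesi–Lauria 2010, Def. 1] [folklore] -/
theorem IsVertexExpander.exists_adj {r : ℕ} {c : ℝ} (h : IsVertexExpander G r c) (hr : 1 ≤ r)
    (hc : 0 < c) (u : V) : ∃ v, G.Adj u v := by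
  have hU := h {u} (by simpa using hr)
  rw [Finset.card_singleton, Nat.cast_one, mul_one] at hU
  have hpos : 0 < (outerNeighbors G {u}).card := by exact_mod_cast hc.trans_le hU
  obtain ⟨v, hv⟩ := Finset.card_pos.1 hpos
  rw [mem_outerNeighbors] at hv
  obtain ⟨-, w, hw, hadj⟩ := hv
  rw [Finset.mem_singleton] at hw
  subst hw
  exact ⟨v, hadj⟩

end Expander

/-! ### GL10's encoding of the graph ordering principle -/

namespace GOP

variable {n : ℕ}

/-- The index of GL10's variable `x_{a,b}` (`a < b`; "`a ≺ b`"): `a·n + b`. [Galesi–Lauria 2010,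
§3 ("Directions are encoded as variables x_{a,b} for any a, b ∈ [n] such that a < b")]
[cite: GalesiLauria2010, §3] -/
def var (n : ℕ) (a b : Fin n) : ℕ := a * n + b

/-- `var` is injective on ordered pairs. [folklore] -/
theorem var_injective {a b a' b' : Fin n} (h : var n a b = var n a' b') : a = a' ∧ b = b' := by
  unfold var at h
  have hb := b.isLt
  have hb' := b'.isLt
  have hn : 0 < n := lt_of_le_of_lt (Nat.zero_le _) hb
  have hdiv : ∀ x y : ℕ, y < n → (x * n + y) / n = x := fun x y hy => by
    rw [show x * n + y = y + x * n by ring, Nat.add_mul_div_right _ _ hn, Nat.div_eq_of_lt hy,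
      zero_add]
  have hmod : ∀ x y : ℕ, y < n → (x * n + y) % n = y := fun x y hy => by
    rw [show x * n + y = y + x * n by ring, Nat.add_mul_mod_self_right, Nat.mod_eq_of_lt hy]
  have e1 := hdiv a b hb
  rw [h, hdiv a' b' hb'] at e1
  have e2 := hmod a b hb
  rw [h, hmod a' b' hb'] at e2
  exact ⟨Fin.ext e1.symm, Fin.ext e2.symm⟩

/-- The literal "`a ≺ b`" (`a ≠ b`): `x_{a,b}` if `a < b`, `¬ x_{b,a}` if `b < a`.
[Galesi–Lauria 2010, §3 (4)] [cite: GalesiLauria2010, §3] -/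
def precLit (n : ℕ) (a b : Fin n) : Literal ℕ :=
  if a < b then (var n a b, true) else (var n b a, false)

/-- The first no-3-cycle clause for `a < b < c`: `¬x_{ab} ∨ ¬x_{bc} ∨ x_{ac}`, whose translation
is GL10's (2) `x_{ab} x_{bc} (1 - x_{ac})`. [Galesi–Lauria 2010, §3 (2)] [cite: GalesiLauria2010, §3 (2)] -/
def transClause₁ (n : ℕ) (a b c : Fin n) : Clause ℕ :=
  [(var n a b, false), (var n b c, false), (var n a c, true)]

/-- The second no-3-cycle clause for `a < b < c`: `x_{ab} ∨ x_{bc} ∨ ¬x_{ac}`, whose translation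
is GL10's (3) `(1 - x_{ab})(1 - x_{bc}) x_{ac}`. [Galesi–Lauria 2010, §3 (3)]
[cite: GalesiLauria2010, §3 (3)] -/
def transClause₂ (n : ℕ) (a b c : Fin n) : Clause ℕ :=
  [(var n a b, true), (var n b c, true), (var n a c, false)]

/-- The no-3-cycle part `T` of `GOP(G)`: both clauses for every `a < b < c`.
[Galesi–Lauria 2010, §3 (2)–(3)] [cite: GalesiLauria2010, §3 (2)-(3)] -/
def transClauses (n : ℕ) : CNF ℕ :=
  (List.finRange n).flatMap fun a => (List.finRange n).flatMap fun b =>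
    (List.finRange n).flatMap fun c =>
      if a < b ∧ b < c then [transClause₁ n a b c, transClause₂ n a b c] else []

variable (G : SimpleGraph (Fin n)) [DecidableRel G.Adj]

/-- The clause `M_u = ⋁_{a ∈ Γ(u)} (a ≺ u)` ("`u` is not ≺-minimal among its neighbours"), whose
translation is GL10's (4) `∏_{a ∈ Γ(u), a < u} (1 - x_{a,u}) · ∏_{a ∈ Γ(u), a > u} x_{u,a}`
(neighbours listed in increasing order). [Galesi–Lauria 2010, §3 (4)] [cite: GalesiLauria2010, §3 (4)] -/
def minClause (u : Fin n) : Clause ℕ :=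
  ((G.neighborFinset u).sort (· ≤ ·)).map fun a => precLit n a u

/-- **GL10's graph ordering principle `GOP(G)`** as a CNF (its `PC.ofCNF`-translation is exactly
GL10's polynomial system `T ∪ {M_u : u ∈ V}`). [Galesi–Lauria 2010, §3 ("We call GOP(G) the union
of T with the equations M_1 … M_n induced by G")] [cite: GalesiLauria2010, §3] -/
def glGOP : CNF ℕ :=
  transClauses n ++ (List.finRange n).map (minClause G)

/-- The no-3-cycle clauses have three literals. [Galesi–Lauria 2010, §3] [folklore] -/
theorem length_of_mem_transClauses {C : Clause ℕ} (hC : C ∈ transClauses n) : C.length = 3 := by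
  simp only [transClauses, List.mem_flatMap, List.mem_finRange, true_and] at hC
  obtain ⟨a, b, c, hC⟩ := hC
  split_ifs at hC with h
  · simp only [List.mem_cons, List.not_mem_nil, or_false] at hC
    rcases hC with rfl | rfl <;> rfl
  · simp at hC

/-- `M_u` has `deg(u)` literals. [Galesi–Lauria 2010, §3 ("Each equation has degree at most equal
to the degree of G")] [folklore] -/
theorem length_minClause (u : Fin n) : (minClause G u).length = G.degree u := by
  rw [minClause, List.length_map, Finset.length_sort, SimpleGraph.card_neighborFinset_eq_degree]

/-- Clause widths of `GOP(G)`: `3` for the no-3-cycle clauses, `deg(u)` for `M_u`; hence all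
`≤ d` as soon as `3 ≤ d` and the maximum degree is `≤ d`. [Galesi–Lauria 2010, §3] [folklore] -/
theorem isWidthLE_glGOP {d : ℕ} (h3 : 3 ≤ d) (hdeg : ∀ u, G.degree u ≤ d) :
    (glGOP G).IsWidthLE d := by
  intro C hC
  rcases List.mem_append.1 hC with hC | hC
  · rw [length_of_mem_transClauses hC]; exact h3
  · obtain ⟨u, -, rfl⟩ := List.mem_map.1 hC
    rw [length_minClause]; exact hdeg u

end GOP

/-! ### The degree lower bound (named fact) -/

/-- NAMED FACT — **Galesi–Lauria's PC degree lower bound for the graph ordering principle**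
(ACM ToCL 2010, Theorem 1, verbatim: "If G is an (r, c)-vertex expander then there is no PC
refutation of GOP(G) of degree less than or equal to cr/4."; PC over an arbitrary field, Boolean
axioms included, §2.1).  Lean statement: for every field `F`, every graph `G` on `Fin n` that is an
`(r, c)`-vertex expander with `r ≥ 1` and `c > 0` (implicit in print, where `r = Θ(n)`, `c = Θ(1)`),
and every `d` with `d ≤ cr/4`, the Krajíček translation of GL10's `GOP(G)` has no PC/F refutation
all of whose lines have degree `≤ d`.  GL10's standing "constant degree" assumption (pp. 7, 9) is
dropped: it is vacuous for a single graph and unused in the proof of Thm 1 (see the design notes;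
DISCHARGED by `GalesiLauria2010_PC_GOP_degree_holds`).  Used (as hypothesis) by the Res(⊕) rail
`Summits/PneNP/PneNP/Theorems/ReslinSizeFromWidthPCDegreeGOP.lean` (rank, clause space, tree-like
size of Res(⊕) refutations of `GOP(G)`; Gryaznov–Ovcharov–Riazanov 2024, Cor. 2 / Thm 9).
[Galesi–Lauria 2010, Thm 1] [cite: GalesiLauria2010, Theorem 1] -/
def GalesiLauria2010_PC_GOP_degree : Prop :=
  ∀ (F : Type) [Field F] (n : ℕ) (G : SimpleGraph (Fin n)) [DecidableRel G.Adj] (r : ℕ) (c : ℝ),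
    1 ≤ r → 0 < c → IsVertexExpander G r c →
      ∀ d : ℕ, (d : ℝ) ≤ c * r / 4 → ¬ PC.RefutableInDegree (PC.ofCNF F (GOP.glGOP G)) d

/-- Unfolded form at one field, one expander and one degree bound. [Galesi–Lauria 2010, Thm 1]
[cite: GalesiLauria2010, Theorem 1] -/
theorem GalesiLauria2010_PC_GOP_degree.not_refutable (h : GalesiLauria2010_PC_GOP_degree)
    (F : Type) [Field F] {n : ℕ} (G : SimpleGraph (Fin n)) [DecidableRel G.Adj] {r : ℕ} {c : ℝ}
    (hr : 1 ≤ r) (hc : 0 < c) (hG : IsVertexExpander G r c) {d : ℕ} (hd : (d : ℝ) ≤ c * r / 4) :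
    ¬ PC.RefutableInDegree (PC.ofCNF F (GOP.glGOP G)) d :=
  h F n G r c hr hc hG d hd

end Literature.Computability.MetaComplexity
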